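import Summits.Ventures.Crystal3D.Theorems.StickyWulffConstantCoaxialWallLawChainCyclic
import Summits.Ventures.Crystal3D.Theorems.StickyWulffConstantCoaxialWallLawForeignTilt
import Summits.Ventures.Crystal3D.Theorems.StickyWulffConstantGenericWallFloorSlotFrameIdentity
import Summits.Ventures.Crystal3D.Theorems.StickyWulffConstantGenericWallFloorCubicCoords
import Summits.Ventures.Crystal3D.Theorems.StickyWulffConstantGenericWallFloorMixedDozenRules
import Mathlib.LinearAlgebra.CrossProduct
import HarnessLib

/-!
# The forced ray in cubic coordinates: ONE PUSH as rational arithmetic (crux `GenericWallFloor`, line `WallLedgerG`)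

HONEST FRAMING. Venture `Summits/Ventures/Crystal3D` (cell `crystal3d-full`), helper `--supports` the crux
`GenericWallFloor` (stmt-Ventures-19480) of `route-Ventures-StickyWulffConstant`, REGISTERED line `WallLedgerG`, open
stub `stub_twoSlabAdhesion`.  Rung credit only; F-C1 not moved; NOT the stub.  Purpose: the DISCHARGE of the
`hdirs` hypothesis of the W1-conditional one-sided walker ledger (cf-p1 (xxxix), §86(86b)): every direction a stack
walker of the terrace-steered steep family can hold rises in the wall normal.  By `entries_forced` the directions a
walker can hold are its start slot and the directions of the two FORCED RAYS `forcedTop z ⟨A,u,0⟩ n k`; this file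
turns one push of a forced ray into exact rational arithmetic in the CUBIC COORDINATES of the base frame `A`
(`cubicCoords (A.symm ·)`, orthonormal, slots `= (±1,±1,0)/√2`).

* `two_point` — pure `ℝ³` algebra: for numerators `X` (`X·X = 2`), `P` (`P·P = 3`, `X·P = 2`) the solutions of
  `Y·Y = 2, Y·P = 2, Y·X = 1` are exactly `(−X ± P × X + 2P)/2` (reciprocal basis `X, P, P × X`).
* `rising_slot_eq_or_inner_half` — a slot of the frame rising through the menu plane `p` like `F v` is `F v` or at
  `60°` from it.
* **`ray_push_cubic`** — ONE PUSH: frame `F`, slot `v`, unit menu normal `p` with `⟪F v, p⟫ = √(2/3)`; numerators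
  `X = √2·κ(F v)`, `P = √3·κ(p)`, steering `κ(z) = t·Z` (`t > 0`), `κ = cubicCoords ∘ A.symm`.  If one member `X_j` of the
  rising triple `{X, (−X + P×X + 2P)/2, (−X − P×X + 2P)/2}` is STRICTLY `Z`-lowest, then the best capper `q` of the
  twin frame `F' = twinFrame F p` has `√2·κ(F' q) = (4/3)P − X_j` and the forced next normal has
  `√3·κ(2√(2/3)·F'q − p) = (5/3)P − 2X_j`.  (Mechanism: the positive slots of `F'` are the mirror images of the three
  rising slots of `F`; `card_far_slots_eq_three` + `two_point` identify them with the triple; `bestCapper_spec`.)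
WHAT THIS IS NOT: no statement about packings or cells; not the stub; F-C1 not moved.
-/

noncomputable section

namespace Summit.Ventures.Crystal3D.Theorems

open Summit.Ventures.Crystal3D Finset Matrix
open scoped InnerProductSpace

/-! ### Pure algebra in `ℝ³` -/

/-- **Two-point lemma.**  For `X·X = 2`, `P·P = 3`, `X·P = 2`, every `Y` with `Y·Y = 2`, `Y·P = 2`, `Y·X = 1` is
`(−X + P × X + 2P)/2` or `(−X − P × X + 2P)/2`. -/
theorem two_point {X P Y : Fin 3 → ℝ} (hXX : X ⬝ᵥ X = 2) (hPP : P ⬝ᵥ P = 3) (hXP : X ⬝ᵥ P = 2)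
    (hYY : Y ⬝ᵥ Y = 2) (hYP : Y ⬝ᵥ P = 2) (hYX : Y ⬝ᵥ X = 1) :
    Y = (1 / 2 : ℝ) • (-X + P ⨯₃ X + (2 : ℝ) • P) ∨ Y = (1 / 2 : ℝ) • (-X - P ⨯₃ X + (2 : ℝ) • P) := by
  set c : Fin 3 → ℝ := P ⨯₃ X with hc
  have hPX : P ⬝ᵥ X = 2 := by rw [dotProduct_comm]; exact hXP
  have hcc : c ⬝ᵥ c = 2 := by rw [hc, cross_dot_cross, hPP, hXX, hPX, hXP]; norm_num
  have hXc : X ⬝ᵥ c = 0 := by rw [hc]; exact dot_cross_self P X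
  have hPc : P ⬝ᵥ c = 0 := by rw [hc]; exact dot_self_cross P X
  have hcX : c ⬝ᵥ X = 0 := by rw [dotProduct_comm]; exact hXc
  have hcP : c ⬝ᵥ P = 0 := by rw [dotProduct_comm]; exact hPc
  set V : Fin 3 → ℝ := Y + (1 / 2 : ℝ) • X - P with hV
  have hXY : X ⬝ᵥ Y = 1 := by rw [dotProduct_comm]; exact hYX
  have hPY : P ⬝ᵥ Y = 2 := by rw [dotProduct_comm]; exact hYP
  have hVX : V ⬝ᵥ X = 0 := by
    rw [hV, sub_dotProduct, add_dotProduct, smul_dotProduct, hYX, hXX, hPX]; norm_num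
  have hVP : V ⬝ᵥ P = 0 := by
    rw [hV, sub_dotProduct, add_dotProduct, smul_dotProduct, hYP, hXP, hPP]; norm_num
  have hVV : V ⬝ᵥ V = 1 / 2 := by
    rw [hV]
    simp only [sub_dotProduct, add_dotProduct, smul_dotProduct, dotProduct_sub, dotProduct_add, dotProduct_smul,
      smul_eq_mul, hYY, hYX, hYP, hXY, hXX, hXP, hPY, hPX, hPP]
    norm_num
  -- `V ⊥ X, P`, so `V × c = 0` and `c × (V × c) = 2V − (V·c)c = 0`
  have hVc0 : V ⨯₃ c = 0 := by
    rw [hc, cross_cross_eq_smul_sub_smul', hVX, dotProduct_comm, hVP, zero_smul, zero_smul, sub_zero]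
  have hkey : (c ⬝ᵥ c) • V - (V ⬝ᵥ c) • c = 0 := by
    rw [← cross_cross_eq_smul_sub_smul', hVc0, (crossProduct c).map_zero]
  rw [hcc] at hkey
  set γ : ℝ := V ⬝ᵥ c with hγ
  have hVeq : V = (γ / 2) • c := by
    have : (2 : ℝ) • V = γ • c := sub_eq_zero.1 hkey
    calc V = (1 / 2 : ℝ) • ((2 : ℝ) • V) := by rw [smul_smul]; norm_num
      _ = (γ / 2) • c := by rw [this, smul_smul]; ring_nf
  have hγ2 : γ ^ 2 = 1 := by
    have h := hVV
    rw [hVeq, smul_dotProduct, dotProduct_smul, smul_eq_mul, smul_eq_mul, hcc] at h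
    nlinarith [h]
  have hY : Y = V - (1 / 2 : ℝ) • X + P := by rw [hV]; module
  have hprod : (γ - 1) * (γ + 1) = 0 := by nlinarith [hγ2]
  rcases mul_eq_zero.1 hprod with h1 | h1
  · left
    have h1' : γ = 1 := by linarith
    rw [hY, hVeq, h1', hc]; module
  · right
    have h1' : γ = -1 := by linarith
    rw [hY, hVeq, h1', hc]; module


/-! ### Lattice geometry of one push -/

/-- **A slot rising through the menu plane like `F v` is `F v` or at `60°` from it.** -/
theorem rising_slot_eq_or_inner_half (F : EuclideanSpace ℝ (Fin 3) ≃ₗᵢ[ℝ] EuclideanSpace ℝ (Fin 3))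
    {p v w : EuclideanSpace ℝ (Fin 3)} (hp : ‖p‖ = 1) (hv : v ∈ fccSlots) (hw : w ∈ fccSlots)
    (hpv : ⟪F v, p⟫_ℝ = Real.sqrt (2 / 3)) (hpw : ⟪F w, p⟫_ℝ = Real.sqrt (2 / 3)) :
    F w = F v ∨ ⟪F w, F v⟫_ℝ = 1 / 2 := by
  obtain ⟨h23, -⟩ := sqrt_twoThirds_facts
  have hvv : ⟪F v, F v⟫_ℝ = 1 := by
    rw [LinearIsometryEquiv.inner_map_map, real_inner_self_eq_norm_sq, norm_eq_one_of_mem_fccSlots hv, one_pow]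
  have hww : ⟪F w, F w⟫_ℝ = 1 := by
    rw [LinearIsometryEquiv.inner_map_map, real_inner_self_eq_norm_sq, norm_eq_one_of_mem_fccSlots hw, one_pow]
  have hpp : ⟪p, p⟫_ℝ = 1 := by rw [real_inner_self_eq_norm_sq, hp, one_pow]
  have hs : ⟪F w, F v⟫_ℝ = ⟪w, v⟫_ℝ := LinearIsometryEquiv.inner_map_map F w v
  -- the components orthogonal to `p` have norm² `1/3`; Cauchy–Schwarz bounds the angle
  set a : EuclideanSpace ℝ (Fin 3) := F w - Real.sqrt (2 / 3) • p with ha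
  set b : EuclideanSpace ℝ (Fin 3) := F v - Real.sqrt (2 / 3) • p with hb
  have hpw' : ⟪p, F w⟫_ℝ = Real.sqrt (2 / 3) := by rw [real_inner_comm]; exact hpw
  have hpv' : ⟪p, F v⟫_ℝ = Real.sqrt (2 / 3) := by rw [real_inner_comm]; exact hpv
  have haa : ⟪a, a⟫_ℝ = 1 / 3 := by
    simp only [ha, inner_sub_left, inner_sub_right, real_inner_smul_left, real_inner_smul_right, hww, hpw, hpw', hpp]
    nlinarith [h23]
  have hbb : ⟪b, b⟫_ℝ = 1 / 3 := by
    simp only [hb, inner_sub_left, inner_sub_right, real_inner_smul_left, real_inner_smul_right, hvv, hpv, hpv', hpp]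
    nlinarith [h23]
  have hab : ⟪a, b⟫_ℝ = ⟪w, v⟫_ℝ - 2 / 3 := by
    simp only [ha, hb, inner_sub_left, inner_sub_right, real_inner_smul_left, real_inner_smul_right, hs, hpw, hpv',
      hpp]
    nlinarith [h23]
  have hCS := real_inner_mul_inner_self_le a b
  rw [haa, hbb, hab] at hCS
  rcases inner_slots_mem hw hv with h | h | h | h | h
  · left
    have h0 : ‖F w - F v‖ ^ 2 = 0 := by
      rw [← real_inner_self_eq_norm_sq, inner_sub_left, inner_sub_right, inner_sub_right, hww, hvv,
        real_inner_comm (F w) (F v), hs, h]; ring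
    have : ‖F w - F v‖ = 0 := by nlinarith [norm_nonneg (F w - F v)]
    exact sub_eq_zero.1 (norm_eq_zero.1 this)
  · right; rw [hs, h]
  · rw [h] at hCS; norm_num at hCS
  · rw [h] at hCS; norm_num at hCS
  · rw [h] at hCS; norm_num at hCS

/-- Cubic coordinates through the base frame turn inner products into dot products. -/
theorem inner_eq_cubic_symm (A : EuclideanSpace ℝ (Fin 3) ≃ₗᵢ[ℝ] EuclideanSpace ℝ (Fin 3))
    (x y : EuclideanSpace ℝ (Fin 3)) : ⟪x, y⟫_ℝ = cubicCoords (A.symm x) ⬝ᵥ cubicCoords (A.symm y) := by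
  rw [← inner_eq_cubicCoords, LinearIsometryEquiv.inner_map_map]

/-- Numeric facts about `√2`, `√3`, `√(2/3)` used below. -/
theorem sqrt_two_three_facts :
    Real.sqrt 2 * Real.sqrt 2 = 2 ∧ Real.sqrt 3 * Real.sqrt 3 = 3 ∧ 0 < Real.sqrt 2 ∧ 0 < Real.sqrt 3 ∧
      Real.sqrt (2 / 3) = Real.sqrt 2 / Real.sqrt 3 :=
  ⟨Real.mul_self_sqrt (by norm_num), Real.mul_self_sqrt (by norm_num), Real.sqrt_pos.2 (by norm_num),
    Real.sqrt_pos.2 (by norm_num), by rw [Real.sqrt_div (by norm_num : (0:ℝ) ≤ 2)]⟩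

/-- **Gram data of the numerators.**  `X = √2·κ(F v)`, `P = √3·κ(p)` for a slot `v` and a unit `p` with
`⟪F v, p⟫ = √(2/3)` satisfy `X·X = 2`, `P·P = 3`, `X·P = 2`; and a second slot `w` with `⟪F w, F v⟫ = 1/2`,
`⟪F w, p⟫ = √(2/3)` has numerator `Y` with `Y·Y = 2`, `Y·P = 2`, `Y·X = 1`. -/
theorem numerator_gram (A F : EuclideanSpace ℝ (Fin 3) ≃ₗᵢ[ℝ] EuclideanSpace ℝ (Fin 3))
    {v p : EuclideanSpace ℝ (Fin 3)} {X P : Fin 3 → ℝ} (hv : v ∈ fccSlots) (hp : ‖p‖ = 1)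
    (hpos : ⟪F v, p⟫_ℝ = Real.sqrt (2 / 3))
    (hX : cubicCoords (A.symm (F v)) = (Real.sqrt 2)⁻¹ • X) (hP : cubicCoords (A.symm p) = (Real.sqrt 3)⁻¹ • P) :
    X ⬝ᵥ X = 2 ∧ P ⬝ᵥ P = 3 ∧ X ⬝ᵥ P = 2 ∧
      ∀ w ∈ fccSlots, ⟪F w, F v⟫_ℝ = 1 / 2 → ⟪F w, p⟫_ℝ = Real.sqrt (2 / 3) →
        ∀ Y : Fin 3 → ℝ, cubicCoords (A.symm (F w)) = (Real.sqrt 2)⁻¹ • Y → Y ⬝ᵥ Y = 2 ∧ Y ⬝ᵥ P = 2 ∧ Y ⬝ᵥ X = 1 := by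
  obtain ⟨hs2, hs3, hs2p, hs3p, h23⟩ := sqrt_two_three_facts
  have κi := inner_eq_cubic_symm A
  have hpp : ⟪p, p⟫_ℝ = 1 := by rw [real_inner_self_eq_norm_sq, hp, one_pow]
  have unit_sq : ∀ {w : EuclideanSpace ℝ (Fin 3)} {Y : Fin 3 → ℝ}, w ∈ fccSlots →
      cubicCoords (A.symm (F w)) = (Real.sqrt 2)⁻¹ • Y → Y ⬝ᵥ Y = 2 := by
    intro w Y hw hY
    have h := κi (F w) (F w)
    rw [LinearIsometryEquiv.inner_map_map, real_inner_self_eq_norm_sq, norm_eq_one_of_mem_fccSlots hw, one_pow, hY,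
      smul_dotProduct, dotProduct_smul, smul_eq_mul, smul_eq_mul] at h
    field_simp at h; nlinarith [h, hs2]
  have cross_p : ∀ {w : EuclideanSpace ℝ (Fin 3)} {Y : Fin 3 → ℝ}, ⟪F w, p⟫_ℝ = Real.sqrt (2 / 3) →
      cubicCoords (A.symm (F w)) = (Real.sqrt 2)⁻¹ • Y → Y ⬝ᵥ P = 2 := by
    intro w Y hw hY
    have h := κi (F w) p
    rw [hw, hY, hP, smul_dotProduct, dotProduct_smul, smul_eq_mul, smul_eq_mul, h23] at h
    field_simp at h
    nlinarith [h, hs2, hs3, hs2p, hs3p]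
  refine ⟨unit_sq hv hX, ?_, cross_p hpos hX, fun w hw hwv hwp Y hY => ⟨unit_sq hw hY, cross_p hwp hY, ?_⟩⟩
  · have h := κi p p
    rw [hpp, hP, smul_dotProduct, dotProduct_smul, smul_eq_mul, smul_eq_mul] at h
    field_simp at h; nlinarith [h, hs3]
  · have h := κi (F w) (F v)
    rw [hwv, hY, hX, smul_dotProduct, dotProduct_smul, smul_eq_mul, smul_eq_mul] at h
    field_simp at h; nlinarith [h, hs2]

/-- **The positive slots of the twin frame are the mirror images of the rising slots of the old frame.**  For a
slot `q` with `⟪twinFrame F p q, p⟫ > 0`: `⟪F q, p⟫ = −√(2/3)`, `twinFrame F p q = 2√(2/3)·p − F(−q)` and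
`⟪F(−q), p⟫ = √(2/3)`. -/
theorem twin_pos_slot (F : EuclideanSpace ℝ (Fin 3) ≃ₗᵢ[ℝ] EuclideanSpace ℝ (Fin 3)) {p q : EuclideanSpace ℝ (Fin 3)}
    (hp : ‖p‖ = 1)
    (hmenu : ∀ w ∈ fccSlots, ⟪F w, p⟫_ℝ = 0 ∨ ⟪F w, p⟫_ℝ = Real.sqrt (2 / 3) ∨ ⟪F w, p⟫_ℝ = -Real.sqrt (2 / 3))
    (hq : q ∈ fccSlots) (hqpos : 0 < ⟪twinFrame F p q, p⟫_ℝ) :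
    twinFrame F p q = (2 * Real.sqrt (2 / 3)) • p - F (-q) ∧ ⟪F (-q), p⟫_ℝ = Real.sqrt (2 / 3) := by
  obtain ⟨h23sq, h45⟩ := sqrt_twoThirds_facts
  have hpp : ⟪p, p⟫_ℝ = 1 := by rw [real_inner_self_eq_norm_sq, hp, one_pow]
  have hF' : ∀ x, twinFrame F p x = F x - (2 * ⟪F x, p⟫_ℝ) • p := twinFrame_apply F hp
  have e : ⟪twinFrame F p q, p⟫_ℝ = -⟪F q, p⟫_ℝ := by rw [hF', inner_sub_left, real_inner_smul_left, hpp]; ring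
  have hneg : ⟪F q, p⟫_ℝ = -Real.sqrt (2 / 3) := by
    rcases hmenu q hq with h | h | h
    · rw [e, h] at hqpos; simp at hqpos
    · rw [e, h] at hqpos; linarith
    · exact h
  refine ⟨?_, ?_⟩
  · rw [hF', hneg, map_neg]; module
  · rw [map_neg, inner_neg_left, hneg, neg_neg]

/-- **Every rising slot has its numerator in the triple, and every member of the triple is realised by a rising slot.**
(Setting of `ray_push_cubic`.) -/
theorem rising_triple (A F : EuclideanSpace ℝ (Fin 3) ≃ₗᵢ[ℝ] EuclideanSpace ℝ (Fin 3))
    {v p : EuclideanSpace ℝ (Fin 3)} {X P : Fin 3 → ℝ} (hv : v ∈ fccSlots) (hp : ‖p‖ = 1)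
    (hmenu : ∀ w ∈ fccSlots, ⟪F w, p⟫_ℝ = 0 ∨ ⟪F w, p⟫_ℝ = Real.sqrt (2 / 3) ∨ ⟪F w, p⟫_ℝ = -Real.sqrt (2 / 3))
    (hpos : ⟪F v, p⟫_ℝ = Real.sqrt (2 / 3))
    (hX : cubicCoords (A.symm (F v)) = (Real.sqrt 2)⁻¹ • X) (hP : cubicCoords (A.symm p) = (Real.sqrt 3)⁻¹ • P) :
    (∀ w ∈ fccSlots, ⟪F w, p⟫_ℝ = Real.sqrt (2 / 3) →
      Real.sqrt 2 • cubicCoords (A.symm (F w)) = X ∨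
      Real.sqrt 2 • cubicCoords (A.symm (F w)) = (1 / 2 : ℝ) • (-X + P ⨯₃ X + (2 : ℝ) • P) ∨
      Real.sqrt 2 • cubicCoords (A.symm (F w)) = (1 / 2 : ℝ) • (-X - P ⨯₃ X + (2 : ℝ) • P)) ∧
    (∀ Y : Fin 3 → ℝ, (Y = X ∨ Y = (1 / 2 : ℝ) • (-X + P ⨯₃ X + (2 : ℝ) • P) ∨
        Y = (1 / 2 : ℝ) • (-X - P ⨯₃ X + (2 : ℝ) • P)) →
      ∃ w ∈ fccSlots, ⟪F w, p⟫_ℝ = Real.sqrt (2 / 3) ∧ cubicCoords (A.symm (F w)) = (Real.sqrt 2)⁻¹ • Y) := by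
  classical
  obtain ⟨hs2, hs3, hs2p, hs3p, h23⟩ := sqrt_two_three_facts
  obtain ⟨hXX, hPP, hXP, hY⟩ := numerator_gram A F hv hp hpos hX hP
  -- every rising slot: in the triple
  have htrip : ∀ w ∈ fccSlots, ⟪F w, p⟫_ℝ = Real.sqrt (2 / 3) →
      Real.sqrt 2 • cubicCoords (A.symm (F w)) = X ∨
      Real.sqrt 2 • cubicCoords (A.symm (F w)) = (1 / 2 : ℝ) • (-X + P ⨯₃ X + (2 : ℝ) • P) ∨
      Real.sqrt 2 • cubicCoords (A.symm (F w)) = (1 / 2 : ℝ) • (-X - P ⨯₃ X + (2 : ℝ) • P) := by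
    intro w hw hpw
    rcases rising_slot_eq_or_inner_half F hp hv hw hpos hpw with h | h
    · left; rw [h, hX, smul_smul, mul_inv_cancel₀ hs2p.ne', one_smul]
    · right
      have hYdef : cubicCoords (A.symm (F w)) = (Real.sqrt 2)⁻¹ • (Real.sqrt 2 • cubicCoords (A.symm (F w))) := by
        rw [smul_smul, inv_mul_cancel₀ hs2p.ne', one_smul]
      obtain ⟨hYY, hYP, hYX⟩ := hY w hw h hpw _ hYdef
      exact two_point hXX hPP hXP hYY hYP hYX
  refine ⟨htrip, ?_⟩
  -- counting: the three rising slots realise the whole triple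
  obtain ⟨g, hg⟩ : ∃ g : EuclideanSpace ℝ (Fin 3) → (Fin 3 → ℝ),
      ∀ w, g w = Real.sqrt 2 • cubicCoords (A.symm (F w)) := ⟨_, fun w => rfl⟩
  have hginj : Function.Injective g := by
    intro w₁ w₂ h
    rw [hg, hg] at h
    have h' : cubicCoords (A.symm (F w₁)) = cubicCoords (A.symm (F w₂)) := by
      have := congrArg (fun Y => (Real.sqrt 2)⁻¹ • Y) h
      simpa only [smul_smul, inv_mul_cancel₀ hs2p.ne', one_smul] using this
    exact F.injective (A.symm.injective (cubicCoords_injective h'))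
  have hS3 : (fccSlots.filter fun w => 0 < ⟪F w, p⟫_ℝ).card = 3 := card_far_slots_eq_three F hp hmenu
  have hSrise : ∀ w ∈ (fccSlots.filter fun w => 0 < ⟪F w, p⟫_ℝ), w ∈ fccSlots ∧ ⟪F w, p⟫_ℝ = Real.sqrt (2 / 3) := by
    intro w hw
    rw [Finset.mem_filter] at hw
    refine ⟨hw.1, ?_⟩
    rcases hmenu w hw.1 with h | h | h
    · rw [h] at hw; exact absurd hw.2 (lt_irrefl 0)
    · exact h
    · rw [h] at hw; linarith [hw.2, Real.sqrt_nonneg (2 / 3)]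
  have hmemT : ∀ Y, (Y = X ∨ Y = (1 / 2 : ℝ) • (-X + P ⨯₃ X + (2 : ℝ) • P) ∨
      Y = (1 / 2 : ℝ) • (-X - P ⨯₃ X + (2 : ℝ) • P)) →
      Y ∈ ({X, (1 / 2 : ℝ) • (-X + P ⨯₃ X + (2 : ℝ) • P), (1 / 2 : ℝ) • (-X - P ⨯₃ X + (2 : ℝ) • P)} :
        Finset (Fin 3 → ℝ)) := by
    rintro Y (rfl | rfl | rfl)
    · exact Finset.mem_insert_self _ _
    · exact Finset.mem_insert_of_mem (Finset.mem_insert_self _ _)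
    · exact Finset.mem_insert_of_mem (Finset.mem_insert_of_mem (Finset.mem_singleton_self _))
  have hsub : (fccSlots.filter fun w => 0 < ⟪F w, p⟫_ℝ).image g ⊆
      ({X, (1 / 2 : ℝ) • (-X + P ⨯₃ X + (2 : ℝ) • P), (1 / 2 : ℝ) • (-X - P ⨯₃ X + (2 : ℝ) • P)} :
        Finset (Fin 3 → ℝ)) := by
    intro Y hYm
    obtain ⟨w, hw, hwY⟩ := Finset.mem_image.1 hYm
    obtain ⟨hw1, hw2⟩ := hSrise w hw
    rw [← hwY, hg]
    exact hmemT _ (htrip w hw1 hw2)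
  have hcardT : ({X, (1 / 2 : ℝ) • (-X + P ⨯₃ X + (2 : ℝ) • P), (1 / 2 : ℝ) • (-X - P ⨯₃ X + (2 : ℝ) • P)} :
        Finset (Fin 3 → ℝ)).card ≤ ((fccSlots.filter fun w => 0 < ⟪F w, p⟫_ℝ).image g).card := by
    rw [Finset.card_image_of_injective _ hginj, hS3]
    exact Finset.card_le_three
  have hST := Finset.eq_of_subset_of_card_le hsub hcardT
  intro Y hYT
  have hYm := hmemT Y hYT
  rw [← hST] at hYm
  obtain ⟨w, hwS, hgw⟩ := Finset.mem_image.1 hYm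
  obtain ⟨hw, hwpos⟩ := hSrise w hwS
  refine ⟨w, hw, hwpos, ?_⟩
  rw [← hgw, hg, smul_smul, inv_mul_cancel₀ hs2p.ne', one_smul]

/-- **ONE PUSH of a forced ray in cubic coordinates.**  See the module docstring. -/
theorem ray_push_cubic (A F : EuclideanSpace ℝ (Fin 3) ≃ₗᵢ[ℝ] EuclideanSpace ℝ (Fin 3))
    {v p z : EuclideanSpace ℝ (Fin 3)} {X P Zc Xj : Fin 3 → ℝ} {t : ℝ}
    (hv : v ∈ fccSlots) (hp : ‖p‖ = 1)
    (hmenu : ∀ w ∈ fccSlots, ⟪F w, p⟫_ℝ = 0 ∨ ⟪F w, p⟫_ℝ = Real.sqrt (2 / 3) ∨ ⟪F w, p⟫_ℝ = -Real.sqrt (2 / 3))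
    (hpos : ⟪F v, p⟫_ℝ = Real.sqrt (2 / 3))
    (hX : cubicCoords (A.symm (F v)) = (Real.sqrt 2)⁻¹ • X)
    (hP : cubicCoords (A.symm p) = (Real.sqrt 3)⁻¹ • P)
    (hZ : cubicCoords (A.symm z) = t • Zc) (ht : 0 < t)
    (hj : Xj = X ∨ Xj = (1 / 2 : ℝ) • (-X + P ⨯₃ X + (2 : ℝ) • P) ∨ Xj = (1 / 2 : ℝ) • (-X - P ⨯₃ X + (2 : ℝ) • P))
    (hlt : ∀ Y : Fin 3 → ℝ, (Y = X ∨ Y = (1 / 2 : ℝ) • (-X + P ⨯₃ X + (2 : ℝ) • P) ∨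
        Y = (1 / 2 : ℝ) • (-X - P ⨯₃ X + (2 : ℝ) • P)) → Y ≠ Xj → Zc ⬝ᵥ Xj < Zc ⬝ᵥ Y) :
    cubicCoords (A.symm (twinFrame F p (bestCapper (twinFrame F p) p z))) =
        (Real.sqrt 2)⁻¹ • ((4 / 3 : ℝ) • P - Xj) ∧
      cubicCoords (A.symm ((2 * Real.sqrt (2 / 3)) • twinFrame F p (bestCapper (twinFrame F p) p z) - p)) =
        (Real.sqrt 3)⁻¹ • ((5 / 3 : ℝ) • P - (2 : ℝ) • Xj) := by
  classical
  obtain ⟨hs2, hs3, hs2p, hs3p, h23⟩ := sqrt_two_three_facts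
  obtain ⟨h23sq, h45⟩ := sqrt_twoThirds_facts
  have hpp : ⟪p, p⟫_ℝ = 1 := by rw [real_inner_self_eq_norm_sq, hp, one_pow]
  have κi := inner_eq_cubic_symm A
  have κsub : ∀ x y : EuclideanSpace ℝ (Fin 3),
      cubicCoords (A.symm (x - y)) = cubicCoords (A.symm x) - cubicCoords (A.symm y) :=
    fun x y => by rw [map_sub, cubicCoords_sub]
  have κsmul : ∀ (r : ℝ) (x : EuclideanSpace ℝ (Fin 3)), cubicCoords (A.symm (r • x)) = r • cubicCoords (A.symm x) :=
    fun r x => by rw [LinearIsometryEquiv.map_smul, cubicCoords_smul]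
  obtain ⟨htrip, hreal⟩ := rising_triple A F hv hp hmenu hpos hX hP
  -- the rising slot `wj` realising `Xj`, and the positive candidate `−wj` of the twin frame
  obtain ⟨wj, hwj, hwjpos, hwjc⟩ := hreal Xj hj
  have hF' : ∀ x, twinFrame F p x = F x - (2 * ⟪F x, p⟫_ℝ) • p := twinFrame_apply F hp
  have hnwj : -wj ∈ fccSlots := neg_mem_fccSlots hwj
  have hF'nwj : twinFrame F p (-wj) = (2 * Real.sqrt (2 / 3)) • p - F wj := by
    rw [hF', map_neg, inner_neg_left, hwjpos]; module
  have hF'nwj_pos : 0 < ⟪twinFrame F p (-wj), p⟫_ℝ := by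
    rw [hF'nwj, inner_sub_left, real_inner_smul_left, hpp, hwjpos]; linarith
  have hne : (fccSlots.filter fun q => 0 < ⟪twinFrame F p q, p⟫_ℝ).Nonempty :=
    ⟨-wj, Finset.mem_filter.2 ⟨hnwj, hF'nwj_pos⟩⟩
  -- the best capper
  obtain ⟨hqmem, hqmax⟩ := bestCapper_spec (twinFrame F p) p z hne
  rw [Finset.mem_filter] at hqmem
  obtain ⟨hq, hqpos⟩ := hqmem
  obtain ⟨hF'q, hrise_nq⟩ := twin_pos_slot F hp hmenu hq hqpos
  have hnq : -bestCapper (twinFrame F p) p z ∈ fccSlots := neg_mem_fccSlots hq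
  obtain ⟨Ys, hYs⟩ : ∃ Y : Fin 3 → ℝ,
      Y = Real.sqrt 2 • cubicCoords (A.symm (F (-bestCapper (twinFrame F p) p z))) := ⟨_, rfl⟩
  have hYs_def : cubicCoords (A.symm (F (-bestCapper (twinFrame F p) p z))) = (Real.sqrt 2)⁻¹ • Ys := by
    rw [hYs, smul_smul, inv_mul_cancel₀ hs2p.ne', one_smul]
  have hYsT : Ys = X ∨ Ys = (1 / 2 : ℝ) • (-X + P ⨯₃ X + (2 : ℝ) • P) ∨
      Ys = (1 / 2 : ℝ) • (-X - P ⨯₃ X + (2 : ℝ) • P) := by rw [hYs]; exact htrip _ hnq hrise_nq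
  -- maximality of the best capper = minimality of `Ys`, hence `Ys = Xj`
  have hmax := hqmax (-wj) (Finset.mem_filter.2 ⟨hnwj, hF'nwj_pos⟩)
  have hle : Zc ⬝ᵥ Ys ≤ Zc ⬝ᵥ Xj := by
    rw [hF'q, hF'nwj, inner_sub_left, inner_sub_left] at hmax
    have h1 : ⟪F (-bestCapper (twinFrame F p) p z), z⟫_ℝ ≤ ⟪F wj, z⟫_ℝ := by linarith
    have e1 : ⟪F (-bestCapper (twinFrame F p) p z), z⟫_ℝ = ((Real.sqrt 2)⁻¹ * t) * (Zc ⬝ᵥ Ys) := by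
      rw [κi, hYs_def, hZ, smul_dotProduct, dotProduct_smul, smul_eq_mul, smul_eq_mul, dotProduct_comm]; ring
    have e2 : ⟪F wj, z⟫_ℝ = ((Real.sqrt 2)⁻¹ * t) * (Zc ⬝ᵥ Xj) := by
      rw [κi, hwjc, hZ, smul_dotProduct, dotProduct_smul, smul_eq_mul, smul_eq_mul, dotProduct_comm]; ring
    have hc : 0 < (Real.sqrt 2)⁻¹ * t := mul_pos (inv_pos.2 hs2p) ht
    rw [e1, e2] at h1
    exact le_of_mul_le_mul_left h1 hc
  have hYsXj : Ys = Xj := by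
    by_contra hne'
    exact absurd (hlt Ys hYsT hne') (not_lt.2 hle)
  -- conclusions
  have hnum1 : 2 * Real.sqrt (2 / 3) * (Real.sqrt 3)⁻¹ = (Real.sqrt 2)⁻¹ * (4 / 3) := by
    rw [h23]; field_simp; nlinarith [hs2, hs3]
  have hnum2 : 2 * Real.sqrt (2 / 3) * (Real.sqrt 2)⁻¹ = 2 * (Real.sqrt 3)⁻¹ := by
    rw [h23]; field_simp
  have hc1 : cubicCoords (A.symm (twinFrame F p (bestCapper (twinFrame F p) p z))) =
      (Real.sqrt 2)⁻¹ • ((4 / 3 : ℝ) • P - Xj) := by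
    rw [hF'q, κsub, κsmul, hP, hYs_def, hYsXj, smul_smul, hnum1, smul_sub, smul_smul]
  refine ⟨hc1, ?_⟩
  rw [κsub, κsmul, hc1, hP, smul_smul, hnum2]
  module

end Summit.Ventures.Crystal3D.Theorems

end
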